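import Mathlib.MeasureTheory.Integral.IntervalIntegral.Basic
import Mathlib.Analysis.Calculus.Deriv.Basic
import Mathlib.Analysis.Calculus.ContDiff.Defs
import Mathlib.Analysis.Real.Sqrt
import Summits.NavierStokesRegularity.TurbBounds.Cutoff
import HarnessLib

/-!
# The rescaled LAYER FORM of the Ra-uniform (P2) family, its one-sided test class, the NAMED REDUCTION HYPOTHESIS,
# and the large-wavenumber CUTOFF step proved in full
(cell `pub-turb` / `turb-bounds`; LEAN-MAP §1–§2 steps 6–7, lead decision 70 (b); files of record HOME/pub-turb-sos/P2-PROOF.md §2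
(= paper Appendix A.7 at PF1), HOME/pub-turb-sos/SPEC-P2.md §1 (1.1), (1.6), (1.7), HOME/PARAM.md §1/§8, refereed lemma sheet
HOME/tribunal/t-lemmas.md passes 1–3 (R-A, R-B, R-P2a–e, R-T PASS). Written by pub-turb-sos, planner-pub-turb-sos-g8-0.)

HONEST FRAMING: rigorous bounds for the stated PDE and boundary conditions; no claim about physical turbulence beyond the bound.
This file contains NO Navier–Stokes / Boussinesq theory. It fixes, as real-analysis objects over Mathlib:

* `gOf s κ η′` — the coupling profile `g(x) = −(sκ/2)·η′((x+1)/2)`, `x ∈ [−1, 1]`, of the member `(s, κ, η′)` (P2-PROOF (2.5) / SPEC-P2 (1.1));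
* `layerIntegrand`, `layerForm` — the rescaled layer quadratic form of SPEC-P2 (1.1) = P2-PROOF (2.5) in the variable `x = 2ζ − 1`,
  `2Q̃_K{V, Θ} = ∫_{−1}^{1} (s−1)[16V″²/K + 8V′² + K V²] + s[4Θ′² + K Θ²] + 2 g V Θ dx`, as an interval integral of total functions
  `V Θ : ℝ → ℝ` (`deriv` = Mathlib's derivative; on the class below these are the classical derivatives and the integrand is continuous,
  so the Bochner integral has no junk value);
* `OneSided V Θ` — the one-sided test class at the wall `x = −1` (SPEC-P2 (1.1) 'admissible class'): `V ∈ C²(ℝ)`, `Θ ∈ C¹(ℝ)`,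
  `V(−1) = V′(−1) = 0`, `Θ(−1) = 0`, NOTHING imposed at `x = +1`;
* `LayerPositivity s κ η′` — statement (★) of P2-PROOF §2.5: the layer form is `≥ 0` on the class for EVERY `K > 0`;
* `LayerReduction Nu` — the NAMED HYPOTHESIS (harness model: a published theorem plus refereed one-page lemmas, USED, never proved here;
  see its docstring for the exact transcription and sources);
* `layerForm_nonneg_of_cutoff`, `layerPositivity_of_cover` — the cutoff step R-P2c(ii) (P2-PROOF 2.6 / SPEC-P2 (1.7) / Appendix A.7 (c))
  PROVED IN FULL from the tree's scalar core `TurbBounds.p2_cutoff_abs` (Cutoff.lean): if `|g| ≤ T` on `[−1, 1]` and `T² ≤ (s−1)·s·K_c²`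
  then for every `K ≥ K_c` the layer integrand is pointwise `≥ 0`, hence the form is `≥ 0` for ALL `V, Θ` (no regularity needed), and
  (★) follows from nonnegativity on the compact range `0 < K ≤ K_c` (the finite certificate's job);
* vacuity guards: `I2_ge_one` (`∫₀¹ η′ = 1 ⇒ I₂ ≥ 1`) and `layerReduction_conduction` (`LayerReduction` holds for the conduction value
  `Nu ≡ 1`, so the hypothesis is satisfiable as typed; that it is not provable for every `Nu` is `Results.P2R0.layerReduction_nontrivial`).

The row files `TurbBounds/Results/<Row>.lean` combine `LayerReduction`, a row-specific named TAIL hypothesis for the row's literal element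
rule, the kernel-checked finite certificate `Certs.<Row>.Evaluator.certificate` and this cutoff theorem into the row's Nusselt bound.
NOT HERE: any formalisation of the Boussinesq equations, of `Nu`, of the background method, or of the Legendre tail lemma.
-/

set_option linter.style.longLine false

noncomputable section

namespace Summit.NavierStokesRegularity.TurbBounds.LayerForm

open MeasureTheory intervalIntegral

/-! ## 1. The member's coupling profile and the layer form (SPEC-P2 (1.1) = P2-PROOF (2.5)) -/

/-- Coupling profile of the member `(s, κ, η′)` on `x ∈ [−1, 1]`: `g(x) = −(sκ/2)·η′((x+1)/2)` (SPEC-P2 (1.1); P2-PROOF (2.5): `g = sτ′`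
on the wall layer, rescaled to `x = 2ζ − 1`). -/
def gOf (s κ : ℝ) (ηp : ℝ → ℝ) (x : ℝ) : ℝ := -(s * κ / 2) * ηp ((x + 1) / 2)

/-- Integrand of the rescaled layer form `2Q̃_K` at wavenumber datum `K = (kδ)² > 0` (SPEC-P2 (1.1), verbatim):
`(s−1)[16V″²/K + 8V′² + K V²] + s[4Θ′² + K Θ²] + 2 g V Θ` at the point `x`. -/
def layerIntegrand (s κ : ℝ) (ηp : ℝ → ℝ) (K : ℝ) (V Θ : ℝ → ℝ) (x : ℝ) : ℝ :=
  (s - 1) * (16 * (deriv (deriv V) x) ^ 2 / K + 8 * (deriv V x) ^ 2 + K * (V x) ^ 2)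
    + s * (4 * (deriv Θ x) ^ 2 + K * (Θ x) ^ 2) + 2 * gOf s κ ηp x * V x * Θ x

/-- The rescaled layer form `2Q̃_K{V, Θ} = ∫_{−1}^{1} layerIntegrand dx` (SPEC-P2 (1.1); interval integral w.r.t. Lebesgue measure). -/
def layerForm (s κ : ℝ) (ηp : ℝ → ℝ) (K : ℝ) (V Θ : ℝ → ℝ) : ℝ :=
  ∫ x in (-1 : ℝ)..1, layerIntegrand s κ ηp K V Θ x

/-- The one-sided test class at the wall `x = −1` (SPEC-P2 (1.1) 'admissible class'; P2-PROOF 2.4–2.5): `V ∈ C²(ℝ)`, `Θ ∈ C¹(ℝ)`,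
`V(−1) = V′(−1) = 0`, `Θ(−1) = 0`; no condition at the far end `x = +1`. (The refereed lemmas R-P2a / R-T are stated on the one-sided
`H² × H¹` class of `[−1, 1]`, in which the restrictions of these functions are dense and on which the form is continuous.) -/
structure OneSided (V Θ : ℝ → ℝ) : Prop where
  /-- `V` is twice continuously differentiable. -/
  hV : ContDiff ℝ 2 V
  /-- `Θ` is continuously differentiable. -/
  hΘ : ContDiff ℝ 1 Θ
  /-- no-slip wall: `V(−1) = 0`. -/
  V_wall : V (-1) = 0
  /-- no-slip wall: `V′(−1) = 0`. -/
  dV_wall : deriv V (-1) = 0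
  /-- isothermal wall: `Θ(−1) = 0`. -/
  Θ_wall : Θ (-1) = 0

/-- Statement (★) of P2-PROOF §2.5 for the member `(s, κ, η′)`: the rescaled layer form is nonnegative on the one-sided class for EVERY
wavenumber datum `K > 0`. -/
def LayerPositivity (s κ : ℝ) (ηp : ℝ → ℝ) : Prop :=
  ∀ K : ℝ, 0 < K → ∀ V Θ : ℝ → ℝ, OneSided V Θ → 0 ≤ layerForm s κ ηp K V Θ

/-- `I₂ = ∫₀¹ η′(ζ)² dζ` — the shape integral of the prefactor `C = s·I₂/(2κ)` (P2-PROOF (2.3)). -/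
def I2 (ηp : ℝ → ℝ) : ℝ := ∫ ζ in (0 : ℝ)..1, ηp ζ ^ 2

/-! ## 2. The named reduction hypothesis (CITED + refereed; used as a hypothesis, never proved in this cell) -/

/-- **Named hypothesis `LayerReduction Nu`** (harness model; lead decision 70 (b)(1)). TRANSCRIPTION, for the referee's line-by-line check:
for every admissible member — `1 < s`, `0 < κ`, `η′` continuous on `[0, 1]` with `∫₀¹ η′ = 1` (P2-PROOF 2.3 / SPEC-P2 §0; there `η′ ∈ ℚ[ζ]`,
a special case) — statement (★) (`LayerPositivity s κ η′`: the form SPEC-P2 (1.1) is `≥ 0` on the one-sided class for all `K > 0`) implies,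
for every `Ra ≥ Ra₀ = 4κ²`, the bound P2-PROOF (2.3): `Nu(Ra) ≤ (s·I₂/(2κ))·Ra^{1/2} − (s − 1)`, `I₂ = ∫₀¹ η′²`.
CONTENT (cited + refereed, NOT proved in this cell): P2-PROOF 2.1 = paper A.1, the affine background-method reduction '(A1) ⇒ (A2)'
[cite: DingKerswell2019, (13)–(16)] (equivalently the Doering–Constantin formulation [cite: DoeringConstantin1996, Sec. III] and
[cite: DoeringGibbon1995, §10.3 (10.3.26)–(10.3.33)]) for the piecewise profile `τ` of P2-PROOF (2.3) with `δ = κ·Ra^{−1/2} ≤ 1/2`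
(`∫₀¹ τ′² = I₂/(2δ)`); P2-PROOF 2.2 = A.2 (horizontal Fourier modes, R-B PASS); the bulk-drop lemma R-P2a (P2-PROOF 2.4 = A.7 (a)) and the
exact Ra-free rescaling R-P2b (P2-PROOF 2.5 = A.7 (b), `K = (kδ)²`, then `x = 2ζ − 1`, SPEC-P2 (1.1)); and the density remark that
`C²(ℝ) × C¹(ℝ)` restricted to `[−1, 1]` is dense in the one-sided `H² × H¹` class on which (★) is stated in P2-PROOF, the form being
continuous there (HOME/tribunal/t-lemmas.md passes 1–3). MEANING OF `Nu`: any function `Nu : ℝ → ℝ` such that, for each `Ra`, `Nu Ra` is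
the Nusselt number `1 + ⟨wT⟩` of SOME admissible (Leray–Hopf, Galerkin-limit) solution of the Boussinesq system between no-slip isothermal
plates at Rayleigh number `Ra` — Prandtl number, horizontal period(s) and `d ∈ {2, 3}` arbitrary (P2-PROOF §1) — e.g. the supremum over all of
them; the cited reduction bounds every such value, so every such `Nu` satisfies `LayerReduction Nu`, and a row theorem
`∀ Nu, LayerReduction Nu → … → Nu Ra ≤ …` is the bound for all solutions. VACUITY: satisfiable as typed (`layerReduction_conduction`), not
provable for every `Nu` unless the tail lemma is refutable (`Results.P2R0.layerReduction_nontrivial`). -/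
def LayerReduction (Nu : ℝ → ℝ) : Prop :=
  ∀ (s κ : ℝ) (ηp : ℝ → ℝ), 1 < s → 0 < κ → ContinuousOn ηp (Set.Icc 0 1) → (∫ ζ in (0 : ℝ)..1, ηp ζ) = 1 →
    LayerPositivity s κ ηp → ∀ Ra : ℝ, 4 * κ ^ 2 ≤ Ra → Nu Ra ≤ s * I2 ηp / (2 * κ) * Real.sqrt Ra - (s - 1)

/-! ## 3. The cutoff step R-P2c(ii), proved (P2-PROOF 2.6 = SPEC-P2 (1.7) = Appendix A.7 (c)) -/

/-- Pointwise cutoff: if `1 ≤ s`, `0 < K_c ≤ K`, `|g(x)| ≤ T` and `T² ≤ (s−1)·s·K_c²` then the layer integrand at `x` is `≥ 0` for ALL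
values of `V, V′, V″, Θ, Θ′` there — the derivative terms are `≥ 0` and are dropped, and the remaining binary form
`(s−1)K V² + sK Θ² + 2gVΘ` is nonnegative by the tree's `p2_cutoff_abs` (TurbBounds/Cutoff.lean). -/
theorem layerIntegrand_nonneg_of_cutoff {s κ T Kc K : ℝ} {ηp : ℝ → ℝ} (hs : 1 ≤ s) (hKc : 0 < Kc)
    (hcut : T ^ 2 ≤ (s - 1) * s * Kc ^ 2) (hK : Kc ≤ K) {x : ℝ} (hg : |gOf s κ ηp x| ≤ T) (V Θ : ℝ → ℝ) :
    0 ≤ layerIntegrand s κ ηp K V Θ x := by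
  have hK0 : 0 < K := lt_of_lt_of_le hKc hK
  have hs1 : 0 ≤ s - 1 := sub_nonneg.mpr hs
  have hs0 : 0 ≤ s := le_trans zero_le_one hs
  have hA : 0 ≤ 16 * (deriv (deriv V) x) ^ 2 / K := div_nonneg (by positivity) hK0.le
  have hB : 0 ≤ 8 * (deriv V x) ^ 2 := by positivity
  have h1 : 0 ≤ (s - 1) * (16 * (deriv (deriv V) x) ^ 2 / K + 8 * (deriv V x) ^ 2) :=
    mul_nonneg hs1 (add_nonneg hA hB)
  have h2 : 0 ≤ s * (4 * (deriv Θ x) ^ 2) := mul_nonneg hs0 (by positivity)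
  have h3 : 0 ≤ (s - 1) * K * (V x) ^ 2 + s * K * (Θ x) ^ 2 + 2 * gOf s κ ηp x * V x * Θ x := by
    have hq := p2_cutoff_abs hs hKc.le hcut hg hK (V x) (-(Θ x))
    have e1 : 2 * gOf s κ ηp x * V x * -(Θ x) = -(2 * gOf s κ ηp x * V x * Θ x) := by ring
    have e2 : (-(Θ x)) ^ 2 = (Θ x) ^ 2 := by ring
    rw [e1, e2] at hq
    linarith
  have e : layerIntegrand s κ ηp K V Θ x
      = (s - 1) * (16 * (deriv (deriv V) x) ^ 2 / K + 8 * (deriv V x) ^ 2) + s * (4 * (deriv Θ x) ^ 2)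
        + ((s - 1) * K * (V x) ^ 2 + s * K * (Θ x) ^ 2 + 2 * gOf s κ ηp x * V x * Θ x) := by
    unfold layerIntegrand; ring
  rw [e]
  exact add_nonneg (add_nonneg h1 h2) h3

/-- **Cutoff step R-P2c(ii) (P2-PROOF 2.6 / SPEC-P2 (1.7)), proved.** If `1 ≤ s`, `0 < K_c`, `|g| ≤ T` on `[−1, 1]` and the
certificate's cutoff line `T² ≤ (s−1)·s·K_c²` holds, then for every `K ≥ K_c` the layer form is nonnegative for ALL `V, Θ : ℝ → ℝ`
(no regularity or wall condition is needed: the integrand is pointwise `≥ 0` on `[−1, 1]`, and the interval integral of a pointwise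
nonnegative function is `≥ 0` — `intervalIntegral.integral_nonneg`, which also covers the non-integrable junk case). -/
theorem layerForm_nonneg_of_cutoff {s κ T Kc : ℝ} {ηp : ℝ → ℝ} (hs : 1 ≤ s) (hKc : 0 < Kc)
    (hg : ∀ x ∈ Set.Icc (-1 : ℝ) 1, |gOf s κ ηp x| ≤ T) (hcut : T ^ 2 ≤ (s - 1) * s * Kc ^ 2)
    {K : ℝ} (hK : Kc ≤ K) (V Θ : ℝ → ℝ) : 0 ≤ layerForm s κ ηp K V Θ := by
  unfold layerForm
  exact intervalIntegral.integral_nonneg (by norm_num) fun x hx =>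
    layerIntegrand_nonneg_of_cutoff hs hKc hcut hK (hg x hx) V Θ

/-- Assembly of (★) from a compact part and the cutoff (P2-PROOF 2.8, first half): if the layer form is `≥ 0` on the one-sided class
for every `0 < K ≤ K_c` (what a finite certificate delivers via the tail lemma) and the cutoff hypotheses hold at `K_c`, then
`LayerPositivity s κ η′`. -/
theorem layerPositivity_of_cover {s κ T Kc : ℝ} {ηp : ℝ → ℝ} (hs : 1 ≤ s) (hKc : 0 < Kc)
    (hg : ∀ x ∈ Set.Icc (-1 : ℝ) 1, |gOf s κ ηp x| ≤ T) (hcut : T ^ 2 ≤ (s - 1) * s * Kc ^ 2)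
    (hfin : ∀ K : ℝ, 0 < K → K ≤ Kc → ∀ V Θ : ℝ → ℝ, OneSided V Θ → 0 ≤ layerForm s κ ηp K V Θ) :
    LayerPositivity s κ ηp := by
  intro K hK V Θ hVΘ
  by_cases hle : K ≤ Kc
  · exact hfin K hK hle V Θ hVΘ
  · exact layerForm_nonneg_of_cutoff hs hKc hg hcut (le_of_lt (not_le.mp hle)) V Θ

/-! ## 4. Vacuity guards for the named hypothesis -/

/-- `∫₀¹ η′ = 1` with `η′` continuous on `[0, 1]` forces `I₂ = ∫₀¹ η′² ≥ 1` (from `∫₀¹ (η′ − 1)² ≥ 0`, i.e. `η′² ≥ 2η′ − 1` pointwise);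
in particular every admissible member's prefactor bound at `Ra = 4κ²` is `≥ 1`. -/
theorem I2_ge_one {ηp : ℝ → ℝ} (hcont : ContinuousOn ηp (Set.Icc 0 1)) (hint : (∫ ζ in (0 : ℝ)..1, ηp ζ) = 1) :
    1 ≤ I2 ηp := by
  have hi : IntervalIntegrable ηp volume 0 1 := ContinuousOn.intervalIntegrable_of_Icc zero_le_one hcont
  have hi2 : IntervalIntegrable (fun ζ => ηp ζ ^ 2) volume 0 1 :=
    ContinuousOn.intervalIntegrable_of_Icc zero_le_one (hcont.pow 2)
  have hlin : IntervalIntegrable (fun ζ => 2 * ηp ζ - 1) volume 0 1 := (hi.const_mul 2).sub intervalIntegrable_const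
  have hmono : (∫ ζ in (0 : ℝ)..1, (2 * ηp ζ - 1)) ≤ ∫ ζ in (0 : ℝ)..1, ηp ζ ^ 2 :=
    intervalIntegral.integral_mono_on zero_le_one hlin hi2 (fun ζ _ => by nlinarith [sq_nonneg (ηp ζ - 1)])
  have hval : (∫ ζ in (0 : ℝ)..1, (2 * ηp ζ - 1)) = 1 := by
    rw [intervalIntegral.integral_sub (hi.const_mul 2) intervalIntegrable_const, intervalIntegral.integral_const_mul, hint]
    norm_num
  unfold I2
  linarith

/-- **Vacuity guard: `LayerReduction` is satisfiable as typed.** The conduction value `Nu ≡ 1` obeys it: for every admissible member and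
every `Ra ≥ 4κ²`, `√Ra ≥ 2κ` and `I₂ ≥ 1` give `(s·I₂/(2κ))·√Ra − (s−1) ≥ s·I₂ − (s−1) ≥ 1`. (So the hypothesis is not refutable in Lean;
that it is not trivially true for every `Nu` is shown in `Results/P2R0.lean` from the certificate.) -/
theorem layerReduction_conduction : LayerReduction (fun _ => 1) := by
  intro s κ ηp hs hκ hcont hint _ Ra hRa
  show (1 : ℝ) ≤ s * I2 ηp / (2 * κ) * Real.sqrt Ra - (s - 1)
  have hI : 1 ≤ I2 ηp := I2_ge_one hcont hint
  have hsq : (2 * κ) ^ 2 ≤ Ra := by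
    have e : (2 * κ) ^ 2 = 4 * κ ^ 2 := by ring
    rw [e]; exact hRa
  have hκ2 : 2 * κ ≤ Real.sqrt Ra := by
    have h := Real.sqrt_le_sqrt hsq
    rwa [Real.sqrt_sq (by linarith : (0 : ℝ) ≤ 2 * κ)] at h
  have hs0 : 0 < s := by linarith
  have hI0 : 0 < I2 ηp := by linarith
  have hA : 0 ≤ s * I2 ηp / (2 * κ) := by positivity
  have hstep : s * I2 ηp / (2 * κ) * (2 * κ) ≤ s * I2 ηp / (2 * κ) * Real.sqrt Ra :=
    mul_le_mul_of_nonneg_left hκ2 hA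
  have hne : (2 * κ) ≠ 0 := by positivity
  have hcancel : s * I2 ηp / (2 * κ) * (2 * κ) = s * I2 ηp := div_mul_cancel₀ (s * I2 ηp) hne
  have hsI : s * 1 ≤ s * I2 ηp := mul_le_mul_of_nonneg_left hI hs0.le
  linarith

end Summit.NavierStokesRegularity.TurbBounds.LayerForm

end
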